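import Summits.AtomisticToContinuum.Crystallization.Theorems.OverbindingBudgetAffineCompressedCutFrame

/-!
# `OverbindingBudget` / crux `RobustDefectLimitWindows` (stmt-AtomisticToContinuum-31280) — «RunCut»: LEVELS OF THE PIVOT DATUM, part A (the two chart steps)

Support file (lens-4 g88, part 17A; memo `g87/memo/SW-CHI.md` §10.8 (3), order (T2-metric)+(β); assembled in `…RunCutLevels`).  The METRIC HALF of (T2): in
the re-based layer-rigidity datum at a base site `i` (`…RunCutRebase.layer_rigidity_rebase_charts`; its clauses are taken here as HYPOTHESES over an abstract
base frame `B` with the two operator bounds `399/400·ν·‖z‖ ≤ ‖B z‖ ≤ 401/400·ν·‖z‖`, ν = `nearestDist y i`, which the record frame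
`(ν • A i) ∘ₗ flipIso s` has by `…Establish.base_lower` / `…Frame.base_upper` and `lower_flip` / `upper_flip`), every level `ℓ ∈ {−2,…,2}` is to carry an
ESTABLISHED site within `2ν` of `y i`.  Levels `0, ±1` come straight from the establishment clause (labels of model norm `≤ 1`, position tolerance
`dR ν 31 = 0.366ν`: distance `≤ 1.369ν`); level `±2` is NOT reachable that way (`401/400·√3 + 0.366 = 2.10 > 2`) and is reached through TWO CHART STEPS:
the cap site `k` at level `±1`, then a cap image `k′ = f_k(v′)` of `k` chosen by the recorded cap signs so that `‖v′ − v″‖² = tsq/18 ≤ 3` for the pattern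
vector `v″` registering `i` from `k` — its class vector is EXACTLY `−r` (`‖B (mv (x″ + r))‖ ≤ T = 0.39ν` forces `tsq < 6`, and a class vector plus an
adjacent cap label is `0` or has `tsq ≥ 6`, `decide`) — so `dist (y k′) (y i) ≤ ν_k·(401/400·7/4 + 2·10⁻⁴) ≤ 1.82ν < 2ν`, with `k′` within the clause
tolerance `T` of the summed label `r + x′` (coordinate sum `±12`).

* §0 label arithmetic: `class_add_cap`, `capv_mem_four`, `exists_second_cap` (`decide`); `thsum² ≤ 3·tsq` and ★ LEVEL SPACING `norm_mv_sq_ge_of_thsum`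
  (a model vector with coordinate sum a non-zero multiple of `6` has norm² `≥ 2/3`); record constants `dR ν 31`, `tauR ν 31`; first-shell recognition `norm_eq_one_of_frame_short`
  (`thsum_tadd` is `…CompressedCutRun`'s).
* §1 `dist_of_estab`, `level_zero_site`, `level_one_site_pos`, `level_one_site_neg` — levels `0, ±1` within `1.369ν`.
* §2 ★★ `step_site` — the second chart step.
-/

namespace Summit.AtomisticToContinuum.Crystallization.Theorems.OverbindingBudgetAffineRunCutLevelsA

open Literature.Geometry.DiscreteGeometry (nearestDist nearestDist_nonneg fccTwoShellPattern hcpTwoShellPattern norm_of_mem_fccTwoShellPattern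
  norm_of_mem_hcpTwoShellPattern)
open Summit.AtomisticToContinuum.Crystallization.Theorems.OverbindingBudgetAffineCompressedCutKernel (T3 tsub tadd tsq thsum fccL fccNegL hcpL hcpAltL)
open Summit.AtomisticToContinuum.Crystallization.Theorems.OverbindingBudgetAffineCompressedCutCharts (mv mv_tadd mv_tsub mv_zero norm_mv_sq
  norm_mv_eq_one_iff Carries)
open Summit.AtomisticToContinuum.Crystallization.Theorems.OverbindingBudgetAffineCompressedCutEstablish (Estab)
open Summit.AtomisticToContinuum.Crystallization.Theorems.OverbindingBudgetAffineCompressedCutSeed (InLayer)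
open Summit.AtomisticToContinuum.Crystallization.Theorems.OverbindingBudgetAffineCompressedCutPatch (capv dL thsum_capv mem_signs)
open Summit.AtomisticToContinuum.Crystallization.Theorems.OverbindingBudgetAffineCompressedCutBudget (tauR dR)
open Summit.AtomisticToContinuum.Crystallization.Theorems.OverbindingBudgetAffineCompressedCutFrame (frame_upper)
open Summit.AtomisticToContinuum.Crystallization.Theorems.OverbindingBudgetAffineCompressedCutRun (thsum_tadd)

variable {N : ℕ}

local notation "E3" => EuclideanSpace ℝ (Fin 3)

/-! ## §0 Label arithmetic -/

/-- A class vector plus one of the four cap labels adjacent to level `0` is `0` or has `tsq ≥ 6`. [this file · kind: computation] -/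
theorem class_add_cap : ∀ C ∈ [fccL, fccNegL, hcpL, hcpAltL], ∀ x ∈ C,
    ∀ r ∈ [((3 : ℤ), (3 : ℤ), (0 : ℤ)), (1, 1, 4), (-1, -1, -4), (-3, -3, 0)], tadd x r = (0, 0, 0) ∨ 6 ≤ tsq (tadd x r) := by
  decide

/-- The cap labels `capv σ ε (1,1,−2)`, `σ, ε = ±1`, are the four listed ones, of `tsq = 18`. [this file] -/
theorem capv_mem_four {σ ε : ℤ} (hσ : σ = 1 ∨ σ = -1) (hε : ε = 1 ∨ ε = -1) :
    capv σ ε (1, 1, -2) ∈ [((3 : ℤ), (3 : ℤ), (0 : ℤ)), (1, 1, 4), (-1, -1, -4), (-3, -3, 0)] ∧ tsq (capv σ ε (1, 1, -2)) = 18 := by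
  rcases hσ with rfl | rfl <;> rcases hε with rfl | rfl <;> decide

/-- Second-cap choice: for cap signs `ε, ε′` there is `δ ∈ dL` with `tsq (capv σ ε (1,1,−2) + capv σ ε′ δ) ≤ 54` (`54` if `ε′ = ε`, `48` else). [this file] -/
theorem exists_second_cap {σ ε ε' : ℤ} (hσ : σ = 1 ∨ σ = -1) (hε : ε = 1 ∨ ε = -1) (hε' : ε' = 1 ∨ ε' = -1) :
    ∃ δ ∈ dL, tsq (tadd (capv σ ε (1, 1, -2)) (capv σ ε' δ)) ≤ 54 ∧ tsq (capv σ ε' δ) = 18 := by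
  rcases hσ with rfl | rfl <;> rcases hε with rfl | rfl <;> rcases hε' with rfl | rfl <;>
    first
    | exact ⟨(1, -2, 1), by decide, by decide, by decide⟩
    | exact ⟨(1, 1, -2), by decide, by decide, by decide⟩

/-- `thsum² ≤ 3·tsq` (Cauchy–Schwarz on three integers). [this file] -/
theorem thsum_sq_le (d : T3) : thsum d ^ 2 ≤ 3 * tsq d := by
  unfold thsum tsq
  nlinarith [sq_nonneg (d.1 - d.2.1), sq_nonneg (d.1 - d.2.2), sq_nonneg (d.2.1 - d.2.2)]

/-- ★ LEVEL SPACING: a model vector whose coordinate sum is a NON-ZERO multiple of `6` has norm² `≥ 2/3`. [this file] -/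
theorem norm_mv_sq_ge_of_thsum {d : T3} {m : ℤ} (h : thsum d = 6 * m) (hm : m ≠ 0) : 2 / 3 ≤ ‖mv d‖ ^ 2 := by
  rw [norm_mv_sq]
  have h1 := thsum_sq_le d
  rw [h] at h1
  have hm2 : 1 ≤ m ^ 2 := by
    rcases lt_or_gt_of_ne hm with hlt | hgt
    · nlinarith
    · nlinarith
  have h12 : (12 : ℤ) ≤ tsq d := by nlinarith
  have h12' : (12 : ℝ) ≤ (tsq d : ℝ) := by exact_mod_cast h12
  linarith

/-- A `tsq` bound is a norm bound: `tsq a ≤ t ≤ 18c²` gives `‖mv a‖ ≤ c`. [this file] -/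
theorem norm_mv_le_of_tsq {a : T3} {t : ℤ} {c : ℝ} (ht : tsq a ≤ t) (hc : 0 ≤ c) (h : (t : ℝ) ≤ 18 * c ^ 2) : ‖mv a‖ ≤ c := by
  have h1 := norm_mv_sq a
  have ht' : (tsq a : ℝ) ≤ t := by exact_mod_cast ht
  nlinarith [norm_nonneg (mv a)]

/-- The record constants: `dR ν 31 = 0.365924ν`, `tauR ν 31 = 0.02418ν`. [this file] -/
theorem dR_tauR_31 (ν : ℝ) : dR ν 31 = 91481 / 250000 * ν ∧ tauR ν 31 = 1209 / 50000 * ν := by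
  constructor
  · simp only [dR]; push_cast; ring
  · simp only [tauR]; push_cast; ring

/-- Points of either two-shell pattern have norm `1` or `√2`. [Literature] -/
theorem norm_of_mem_pattern {P : Finset E3} (hP : P = fccTwoShellPattern ∨ P = hcpTwoShellPattern) {v : E3} (hv : v ∈ P) :
    ‖v‖ = 1 ∨ ‖v‖ = Real.sqrt 2 := by
  rcases hP with rfl | rfl
  · exact norm_of_mem_fccTwoShellPattern hv
  · exact norm_of_mem_hcpTwoShellPattern hv

/-- A pattern vector whose frame image has norm `< 1.4` (frame within `10⁻³` of an isometry on the pattern) is a FIRST-shell vector. [this file] -/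
theorem norm_eq_one_of_frame_short {P : Finset E3} (hP : P = fccTwoShellPattern ∨ P = hcpTwoShellPattern) {A : E3 →ₗ[ℝ] E3} {Q : E3 →ₗᵢ[ℝ] E3}
    (hA : ∀ v ∈ P, ‖A v - Q v‖ ≤ 1 / 1000) {v : E3} (hv : v ∈ P) (hs : ‖A v‖ < 7 / 5) : ‖v‖ = 1 := by
  rcases norm_of_mem_pattern hP hv with h | h
  · exact h
  · exfalso
    have h1 := hA v hv
    have h2 : ‖Q v‖ - ‖A v‖ ≤ ‖A v - Q v‖ := by
      rw [← norm_neg (A v - Q v), neg_sub]; exact norm_sub_norm_le _ _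
    rw [Q.norm_map, h] at h2
    have h3 : (141 / 100 : ℝ) < Real.sqrt 2 := by
      rw [show (141 / 100 : ℝ) = Real.sqrt ((141 / 100) ^ 2) by rw [Real.sqrt_sq (by norm_num)]]
      exact Real.sqrt_lt_sqrt (by norm_num) (by norm_num)
    linarith

section Datum

variable {y : Fin N → E3} {i : Fin N} {A : Fin N → (E3 →ₗ[ℝ] E3)} {Qf : Fin N → (E3 →ₗᵢ[ℝ] E3)} {P : Fin N → Finset E3} {f : Fin N → E3 → E3}
  {B : E3 →ₗ[ℝ] E3} {ref : ℤ → T3} {Cz : ℤ → List T3} {e : ℤ → ℤ}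

variable (hν : 0 < nearestDist y i)
  (hP : ∀ j, dist (y j) (y i) ≤ 12 * nearestDist y i → (P j = fccTwoShellPattern ∨ P j = hcpTwoShellPattern))
  (hA : ∀ j, dist (y j) (y i) ≤ 12 * nearestDist y i → ∀ v ∈ P j, ‖A j v - Qf j v‖ ≤ 1 / 1000)
  (hf : ∀ j, dist (y j) (y i) ≤ 12 * nearestDist y i → ∀ v ∈ P j,
    f j v ∈ Set.range y ∧ dist (f j v) (y j + nearestDist y j • A j v) ≤ 1 / 10 ^ 4 * nearestDist y j)
  (hex : ∀ j, dist (y j) (y i) ≤ 12 * nearestDist y i → ∀ m, m ≠ j → dist (y m) (y j) ≤ (3 / 2 + 1 / 450) * nearestDist y j →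
    ∃ v ∈ P j, f j v = y m)
  (hBlo : ∀ z, 399 / 400 * nearestDist y i * ‖z‖ ≤ ‖B z‖) (hBup : ∀ z, ‖B z‖ ≤ 401 / 400 * nearestDist y i * ‖z‖)
  (hC1 : ∀ ℓ : ℤ, -5 ≤ ℓ → ℓ ≤ 5 → Cz ℓ ∈ [fccL, fccNegL, hcpL, hcpAltL] ∧ thsum (ref ℓ) = 6 * ℓ ∧ (ref ℓ).2.1 = (ref ℓ).1 ∧
      (3 : ℤ) ∣ ((ref ℓ).2.1 - (ref ℓ).2.2) ∧
      ∀ u : T3, InLayer (tsub (tadd (2 * ℓ, 2 * ℓ, 2 * ℓ) u) (ref ℓ)) → |u.1| ≤ 18 - |ℓ| → |u.2.1| ≤ 18 - |ℓ| → |u.2.2| ≤ 18 - |ℓ| →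
        ∃ k : Fin N, ∃ M : E3 →ₗᵢ[ℝ] E3,
          dist (y k) (y i) ≤ 12 * nearestDist y i ∧ 9026 / 10000 * nearestDist y i ≤ nearestDist y k ∧
          nearestDist y k ≤ 10347 / 10000 * nearestDist y i ∧
          Estab y A P B i k M (Cz ℓ) (tadd (2 * ℓ, 2 * ℓ, 2 * ℓ) u) (tauR (nearestDist y i) 31) (dR (nearestDist y i) 31))
  (hC2 : ∀ ℓ : ℤ, -5 ≤ ℓ → ℓ ≤ 4 → (e ℓ = 1 ∨ e ℓ = -1) ∧ ref (ℓ + 1) = tadd (ref ℓ) (capv 1 (e ℓ) (1, 1, -2)) ∧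
      (∀ δ ∈ dL, capv 1 (e ℓ) δ ∈ Cz ℓ) ∧ (∀ δ ∈ dL, capv (-1) (-(e ℓ)) δ ∈ Cz (ℓ + 1)))
  (hC3 : ∃ x₀ : T3, InLayer x₀ ∧ tadd (ref 0) x₀ = (0, 0, 0))

/-! ## §1 Levels `0`, `±1`: established sites within `1.369ν` straight from the establishment clause -/

section LevelOne

include hν hBup

/-- Distance of an established site from the base: `≤ 401/400·ν·‖mv λ‖ + dR ν 31 ≤ 1.369ν` for a label of `tsq ≤ 18`. [this file] -/
theorem dist_of_estab {k : Fin N} {M : E3 →ₗᵢ[ℝ] E3} {C : List T3} {lam : T3}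
    (hE : Estab y A P B i k M C lam (tauR (nearestDist y i) 31) (dR (nearestDist y i) 31)) (hl : tsq lam ≤ 18) :
    dist (y k) (y i) ≤ 1369 / 1000 * nearestDist y i := by
  have hD := (dR_tauR_31 (nearestDist y i)).1
  have hpos := hE.2.2
  rw [hD] at hpos
  have h1 : ‖mv lam‖ ≤ 1 := norm_mv_le_of_tsq hl (by norm_num) (by norm_num)
  have h2 := hBup (mv lam)
  have h3 : ‖B (mv lam)‖ ≤ 401 / 400 * nearestDist y i := by nlinarith
  rw [dist_eq_norm]
  have e1 : y k - y i = (y k - y i - B (mv lam)) + B (mv lam) := by abel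
  rw [e1]
  exact (norm_add_le _ _).trans (by linarith)

include hC1 hC3

/-- **LEVEL 0**: the base label `(0,0,0)` is established (class `Cz 0`). [this file] -/
theorem level_zero_site : ∃ (k : Fin N) (M : E3 →ₗᵢ[ℝ] E3), dist (y k) (y i) ≤ 1369 / 1000 * nearestDist y i ∧
    9026 / 10000 * nearestDist y i ≤ nearestDist y k ∧ nearestDist y k ≤ 10347 / 10000 * nearestDist y i ∧
    Estab y A P B i k M (Cz 0) (0, 0, 0) (tauR (nearestDist y i) 31) (dR (nearestDist y i) 31) := by
  obtain ⟨x₀, hx₀L, hx₀⟩ := hC3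
  obtain ⟨-, -, -, -, hsite⟩ := hC1 0 (by norm_num) (by norm_num)
  simp only [tadd, Prod.mk.injEq] at hx₀
  obtain ⟨h1, h2, h3⟩ := hx₀
  have hlab : tsub (tadd (2 * 0, 2 * 0, 2 * 0) ((0 : ℤ), (0 : ℤ), (0 : ℤ))) (ref 0) = x₀ := by
    refine Prod.ext ?_ (Prod.ext ?_ ?_) <;> simp only [tadd, tsub] <;> linarith
  obtain ⟨k, M, hd, hlo, hhi, hE⟩ := hsite (0, 0, 0) (by rw [hlab]; exact hx₀L) (by simp) (by simp) (by simp)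
  have hr : tadd (2 * 0, 2 * 0, 2 * 0) ((0 : ℤ), (0 : ℤ), (0 : ℤ)) = (0, 0, 0) := by
    refine Prod.ext ?_ (Prod.ext ?_ ?_) <;> simp only [tadd] <;> ring
  rw [hr] at hE
  exact ⟨k, M, dist_of_estab hν hBup hE (by decide), hlo, hhi, hE⟩

end LevelOne

section LevelOnePM

include hν hBup hC1 hC2 hC3

/-- **LEVEL +1**: the cap label `capv 1 (e 0) (1,1,−2)` is established (class `Cz 1`), within `1.369ν`. [this file] -/
theorem level_one_site_pos : ∃ (k : Fin N) (M : E3 →ₗᵢ[ℝ] E3), dist (y k) (y i) ≤ 1369 / 1000 * nearestDist y i ∧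
    9026 / 10000 * nearestDist y i ≤ nearestDist y k ∧ nearestDist y k ≤ 10347 / 10000 * nearestDist y i ∧
    Estab y A P B i k M (Cz 1) (capv 1 (e 0) (1, 1, -2)) (tauR (nearestDist y i) 31) (dR (nearestDist y i) 31) := by
  obtain ⟨x₀, hx₀L, hx₀⟩ := hC3
  obtain ⟨he0, href, -, -⟩ := hC2 0 (by norm_num) (by norm_num)
  simp only [zero_add] at href
  obtain ⟨-, -, -, -, hsite⟩ := hC1 1 (by norm_num) (by norm_num)
  have hx := hx₀
  simp only [tadd, Prod.mk.injEq] at hx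
  obtain ⟨h1, h2, h3⟩ := hx
  have hlab : tsub (tadd (2 * 1, 2 * 1, 2 * 1) (e 0, e 0, -2 * e 0)) (ref 1) = x₀ := by
    rw [href]
    refine Prod.ext ?_ (Prod.ext ?_ ?_) <;> simp only [tadd, tsub, capv] <;> linarith
  have hb : |e 0| ≤ 18 - |(1 : ℤ)| ∧ |-2 * e 0| ≤ 18 - |(1 : ℤ)| := by
    rcases he0 with h | h <;> simp [h]
  obtain ⟨k, M, hd, hlo, hhi, hE⟩ := hsite (e 0, e 0, -2 * e 0) (by rw [hlab]; exact hx₀L) hb.1 hb.1 hb.2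
  have hr : tadd (2 * 1, 2 * 1, 2 * 1) (e 0, e 0, -2 * e 0) = capv 1 (e 0) (1, 1, -2) := by
    refine Prod.ext ?_ (Prod.ext ?_ ?_) <;> simp only [tadd, capv] <;> ring
  rw [hr] at hE
  exact ⟨k, M, dist_of_estab hν hBup hE (capv_mem_four (Or.inl rfl) he0).2.le, hlo, hhi, hE⟩

/-- **LEVEL −1**: the cap label `capv (−1) (−e(−1)) (1,1,−2)` is established (class `Cz (−1)`), within `1.369ν`. [this file] -/
theorem level_one_site_neg : ∃ (k : Fin N) (M : E3 →ₗᵢ[ℝ] E3), dist (y k) (y i) ≤ 1369 / 1000 * nearestDist y i ∧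
    9026 / 10000 * nearestDist y i ≤ nearestDist y k ∧ nearestDist y k ≤ 10347 / 10000 * nearestDist y i ∧
    Estab y A P B i k M (Cz (-1)) (capv (-1) (-(e (-1))) (1, 1, -2)) (tauR (nearestDist y i) 31) (dR (nearestDist y i) 31) := by
  obtain ⟨x₀, hx₀L, hx₀⟩ := hC3
  obtain ⟨he, href, -, -⟩ := hC2 (-1) (by norm_num) (by norm_num)
  rw [show (-1 : ℤ) + 1 = 0 from by norm_num] at href
  obtain ⟨-, -, -, -, hsite⟩ := hC1 (-1) (by norm_num) (by norm_num)
  have hx := hx₀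
  rw [href] at hx
  simp only [tadd, capv, Prod.mk.injEq] at hx
  obtain ⟨h1, h2, h3⟩ := hx
  have hlab : tsub (tadd (2 * (-1), 2 * (-1), 2 * (-1)) (-(e (-1)), -(e (-1)), 2 * e (-1))) (ref (-1)) = x₀ := by
    refine Prod.ext ?_ (Prod.ext ?_ ?_) <;> simp only [tadd, tsub] <;> linarith
  have hb : |-(e (-1))| ≤ 18 - |(-1 : ℤ)| ∧ |2 * e (-1)| ≤ 18 - |(-1 : ℤ)| := by
    rcases he with h | h <;> simp [h]
  obtain ⟨k, M, hd, hlo, hhi, hE⟩ := hsite (-(e (-1)), -(e (-1)), 2 * e (-1)) (by rw [hlab]; exact hx₀L) hb.1 hb.1 hb.2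
  have hr : tadd (2 * (-1), 2 * (-1), 2 * (-1)) (-(e (-1)), -(e (-1)), 2 * e (-1)) = capv (-1) (-(e (-1))) (1, 1, -2) := by
    refine Prod.ext ?_ (Prod.ext ?_ ?_) <;> simp only [tadd, capv] <;> ring
  rw [hr] at hE
  have he' : -(e (-1)) = 1 ∨ -(e (-1)) = -1 := by rcases he with h | h <;> simp [h]
  exact ⟨k, M, dist_of_estab hν hBup hE (capv_mem_four (Or.inr rfl) he').2.le, hlo, hhi, hE⟩

end LevelOnePM

/-! ## §2 The second chart step -/

section Step

include hν hP hA hf hex hBlo hBup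
set_option maxHeartbeats 400000 in
/-- ★ **THE SECOND CHART STEP.**  `k` established at a cap label `r` adjacent to level `0` (class `C`, record tolerances), with the record scale
bounds; `x′ ∈ C` a first-shell class vector with `tsq (r + x′) ≤ 54`.  Then the site `k′ := f_k(M_k⁻¹(mv x′))` lies within `2ν_i` of `y i` and within the
clause tolerance `T = dR ν 31 + 10⁻⁴·(10347/10000·ν) + tauR ν 31` of the label `r + x′`.  (The pattern vector `v″` registering `i` from `k` has class
vector EXACTLY `−r`: `‖B (mv (x″ + r))‖ ≤ T` forces `tsq (x″ + r) < 6`, and `class_add_cap`.) [this file · kind: proof] -/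
theorem step_site {k : Fin N} {M : E3 →ₗᵢ[ℝ] E3} {C : List T3} {r x' : T3}
    (hE : Estab y A P B i k M C r (tauR (nearestDist y i) 31) (dR (nearestDist y i) 31)) (hC : C ∈ [fccL, fccNegL, hcpL, hcpAltL])
    (hr : r ∈ [((3 : ℤ), (3 : ℤ), (0 : ℤ)), (1, 1, 4), (-1, -1, -4), (-3, -3, 0)]) (hr18 : tsq r = 18)
    (hlo : 9026 / 10000 * nearestDist y i ≤ nearestDist y k) (hhi : nearestDist y k ≤ 10347 / 10000 * nearestDist y i)
    (hx' : x' ∈ C) (hx18 : tsq x' = 18) (h54 : tsq (tadd r x') ≤ 54) :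
    ∃ k' : Fin N, dist (y k') (y i) ≤ 2 * nearestDist y i ∧
      ‖y k' - y i - B (mv (tadd r x'))‖ ≤ dR (nearestDist y i) 31 + 1 / 10 ^ 4 * (10347 / 10000 * nearestDist y i) + tauR (nearestDist y i) 31 := by
  obtain ⟨hD, hτ⟩ := dR_tauR_31 (nearestDist y i)
  have hpos := hE.2.2
  have hmr : ‖mv r‖ = 1 := (norm_mv_eq_one_iff r).2 hr18
  have hBr := hBup (mv r)
  have hBr' := hBlo (mv r)
  rw [hmr, mul_one] at hBr hBr'
  have hdk : dist (y k) (y i) ≤ 1369 / 1000 * nearestDist y i := by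
    rw [dist_eq_norm]
    have e1 : y k - y i = (y k - y i - B (mv r)) + B (mv r) := by abel
    rw [e1]
    exact (norm_add_le _ _).trans (by linarith)
  have hki : k ≠ i := by
    intro h
    rw [h, sub_self, zero_sub, norm_neg] at hpos
    linarith
  -- i's chart registers k by a FIRST-shell vector
  have hi0 : dist (y i) (y i) ≤ 12 * nearestDist y i := by rw [dist_self]; positivity
  obtain ⟨v, hvP, hvk⟩ := hex i hi0 k hki (hdk.trans (by nlinarith))
  have hfv := (hf i hi0 v hvP).2
  rw [hvk, dist_eq_norm] at hfv
  have hAv : ‖A i v‖ < 7 / 5 := by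
    have h1 := norm_sub_le (y k - y i) (y k - (y i + nearestDist y i • A i v))
    have e2 : (y k - y i) - (y k - (y i + nearestDist y i • A i v)) = nearestDist y i • A i v := by abel
    rw [e2, norm_smul, Real.norm_of_nonneg hν.le] at h1
    have hnk : ‖y k - y i‖ ≤ 1369 / 1000 * nearestDist y i := by rw [← dist_eq_norm]; exact hdk
    by_contra hc
    rw [not_lt] at hc
    nlinarith [mul_le_mul_of_nonneg_left hc hν.le]
  have hv1 : ‖v‖ = 1 := norm_eq_one_of_frame_short (hP i hi0) (hA i hi0) hvP hAv
  have hAiv : ‖A i v‖ ≤ 1001 / 1000 := by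
    have h1 := hA i hi0 v hvP
    have h2 : ‖A i v‖ - ‖Qf i v‖ ≤ ‖A i v - Qf i v‖ := norm_sub_norm_le _ _
    rw [(Qf i).norm_map, hv1] at h2
    linarith
  have hdk1 : dist (y k) (y i) ≤ 10011 / 10000 * nearestDist y i := by
    rw [dist_eq_norm]
    have e3 : y k - y i = (y k - (y i + nearestDist y i • A i v)) + nearestDist y i • A i v := by abel
    rw [e3]
    refine (norm_add_le _ _).trans ?_
    rw [norm_smul, Real.norm_of_nonneg hν.le]
    nlinarith [mul_le_mul_of_nonneg_left hAiv hν.le]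
  -- k's chart registers i
  have hk12 : dist (y k) (y i) ≤ 12 * nearestDist y i := hdk1.trans (by nlinarith)
  have hik : dist (y i) (y k) ≤ (3 / 2 + 1 / 450) * nearestDist y k := by rw [dist_comm]; nlinarith
  obtain ⟨v'', hv''P, hv''i⟩ := hex k hk12 i hki.symm hik
  have hfv'' := (hf k hk12 v'' hv''P).2
  rw [hv''i, dist_eq_norm] at hfv''
  have hνk0 : 0 ≤ nearestDist y k := nearestDist_nonneg y k
  have hAv'' : ‖A k v''‖ < 7 / 5 := by
    have h1 := norm_sub_le (-(y i - (y k + nearestDist y k • A k v''))) (y k - y i)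
    have e2 : -(y i - (y k + nearestDist y k • A k v'')) - (y k - y i) = nearestDist y k • A k v'' := by abel
    rw [e2, norm_neg, norm_smul, Real.norm_of_nonneg hνk0] at h1
    have hnk : ‖y k - y i‖ ≤ 10011 / 10000 * nearestDist y i := by rw [← dist_eq_norm]; exact hdk1
    by_contra hc
    rw [not_lt] at hc
    nlinarith [mul_le_mul_of_nonneg_left hc hνk0]
  have hv''1 : ‖v''‖ = 1 := norm_eq_one_of_frame_short (hP k hk12) (hA k hk12) hv''P hAv''
  -- the class vector of v″ is EXACTLY −r
  obtain ⟨x'', hx''C, hMv''⟩ := hE.1.1 v'' hv''P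
  have hlink'' := hE.2.1 v''
  rw [hv''1, mul_one, hMv''] at hlink''
  have hsum : ‖B (mv (tadd x'' r))‖ ≤
      dR (nearestDist y i) 31 + 1 / 10 ^ 4 * (10347 / 10000 * nearestDist y i) + tauR (nearestDist y i) 31 := by
    have e4 : B (mv (tadd x'' r)) = -((y i - (y k + nearestDist y k • A k v'')) + (nearestDist y k • A k v'' - B (mv x'')) +
        (y k - y i - B (mv r))) := by
      rw [mv_tadd, B.map_add]; abel
    rw [e4, norm_neg]
    refine ((norm_add_le _ _).trans (add_le_add ((norm_add_le _ _).trans (add_le_add hfv'' hlink'')) hpos)).trans ?_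
    nlinarith
  have hsmall : tsq (tadd x'' r) < 6 := by
    have h1 := hBlo (mv (tadd x'' r))
    have h2 := norm_mv_sq (tadd x'' r)
    rw [hD, hτ] at hsum
    have hm : ‖mv (tadd x'' r)‖ ≤ 2 / 5 := by
      by_contra hc
      rw [not_le] at hc
      nlinarith [mul_le_mul_of_nonneg_left hc.le hν.le]
    have h3 : (tsq (tadd x'' r) : ℝ) < 6 := by nlinarith [norm_nonneg (mv (tadd x'' r))]
    exact_mod_cast h3
  have h0 : tadd x'' r = (0, 0, 0) := by
    rcases class_add_cap C hC x'' hx''C r hr with h | h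
    · exact h
    · exact absurd h (not_le.mpr hsmall)
  have hxr : mv x'' = -mv r := by
    have h := congrArg mv h0
    rw [mv_tadd, mv_zero] at h
    exact eq_neg_of_add_eq_zero_left h
  -- the second step
  obtain ⟨v', hv'P, hMv'⟩ := hE.1.2 x' hx'
  obtain ⟨⟨k', hk'⟩, hfv'⟩ := hf k hk12 v' hv'P
  rw [← hk', dist_eq_norm] at hfv'
  have hv'1 : ‖v'‖ = 1 := by rw [← M.norm_map v', hMv']; exact (norm_mv_eq_one_iff x').2 hx18
  have hvv : ‖v' - v''‖ = ‖mv (tadd r x')‖ := by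
    rw [← M.norm_map (v' - v''), map_sub, hMv', hMv'', hxr, mv_tadd, sub_neg_eq_add, add_comm]
  have h3 : ‖mv (tadd r x')‖ ≤ 7 / 4 := norm_mv_le_of_tsq h54 (by norm_num) (by norm_num)
  have hAop := frame_upper (hP k hk12) (hA k hk12) (v' - v'')
  rw [hvv] at hAop
  refine ⟨k', ?_, ?_⟩
  · have h1 := norm_add_le ((y k' - (y k + nearestDist y k • A k v')) + nearestDist y k • A k (v' - v''))
      (-(y i - (y k + nearestDist y k • A k v'')))
    have h2 := norm_add_le (y k' - (y k + nearestDist y k • A k v')) (nearestDist y k • A k (v' - v''))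
    have e5 : (y k' - (y k + nearestDist y k • A k v')) + nearestDist y k • A k (v' - v'') +
        (-(y i - (y k + nearestDist y k • A k v''))) = y k' - y i := by
      rw [(A k).map_sub, smul_sub]; abel
    rw [e5, norm_neg] at h1
    have h4 : ‖nearestDist y k • A k (v' - v'')‖ ≤ nearestDist y k * ((1 + 5 / 2 * (1 / 1000)) * (7 / 4)) := by
      rw [norm_smul, Real.norm_of_nonneg hνk0]
      exact mul_le_mul_of_nonneg_left (hAop.trans (mul_le_mul_of_nonneg_left h3 (by norm_num))) hνk0
    rw [dist_eq_norm]
    linarith [h1, h2, hfv', h4, hfv'', hhi]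
  · have hlink' := hE.2.1 v'
    rw [hv'1, mul_one, hMv'] at hlink'
    have h1 := norm_add_le ((y k' - (y k + nearestDist y k • A k v')) + (nearestDist y k • A k v' - B (mv x'))) (y k - y i - B (mv r))
    have h2 := norm_add_le (y k' - (y k + nearestDist y k • A k v')) (nearestDist y k • A k v' - B (mv x'))
    have e6 : (y k' - (y k + nearestDist y k • A k v')) + (nearestDist y k • A k v' - B (mv x')) + (y k - y i - B (mv r)) =
        y k' - y i - B (mv (tadd r x')) := by
      rw [mv_tadd, B.map_add]; abel
    rw [e6] at h1
    linarith

end Step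

end Datum

end Summit.AtomisticToContinuum.Crystallization.Theorems.OverbindingBudgetAffineRunCutLevelsA
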